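import Literature.Geometry.Symplectic.SteinRegularDomain
import Literature.Geometry.Symplectic.SteinDomainShrinking
import Literature.Geometry.Symplectic.SteinDomainComponents
import Literature.Topology.FourManifolds.InteriorConnected
import Literature.Topology.FourManifolds.MorseExtrema
import HarnessLib

/-!
# Shrinking a Stein domain into its interior as a Stein domain: the structure on `{φ ≤ c}`

Topic `Literature/Geometry/Symplectic`; proofs file of the fact seat of
`Literature.Geometry.Symplectic.Gompf1998_thm13_twoHandles` (**E2**, `SteinTwoHandles.lean`:
Eliashberg's theorem on 2-handles attached to a Stein domain along Legendrian knots of framing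
`tb - 1`).  The printed proofs of E2 (Eliashberg 1990, §3; Cieliebak–Eliashberg 2012, Thm. 1.5
with Ch. 8; Gompf 1998, the paragraph after Thm. 1.3) take place in an *open* complex surface
`V` containing the Stein domain as a regular sublevel set `{φ ≤ c}` of a `J`-convex function;
the tree's `SteinStructure W` is instead an abstract compact complex surface with `J`-convex
boundary, `J` being given on `W` only.  The first step of E2's proof for the tree's notion is
therefore to replace `W` by a high sublevel set `W_c = {φ ≤ c} ⊂ int W` — diffeomorphic to `W`
(`SteinDomainShrinking.lean`, Milnor's regular interval theorem) — *together with the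
restricted Stein structure* `(J|W_c, φ|W_c)`, so that `W_c` is a Stein domain sitting inside the
open complex surface `int W` exactly as in the sources.  This file constructs that restricted
structure (everything **proved**; no named fact):

* `SteinStructure.subAtlas` (the tree's `sublevelAtlas` of `{φ ≤ c}`), `subJ = (Dι)⁻¹ J Dι`
  (`RegularDomain.domJ` of `SteinRegularDomain.lean`), `subφ = φ ∘ ι`;
* `SteinStructure.mextDeriv_dComplex_sub_apply` — the Levi form of `φ ∘ ι` for `J^c` is that of
  `φ` on `Dι`-images (naturality of the tree's `d`, `Literature.Geometry.Kaehler.mextDeriv_pullback_apply`,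
  `d^ℂφ` a smooth form, `isSmoothForm_dComplex`);
* **`SteinStructure.sublevel`** — the Stein structure on `↥(φ ⁻¹' Iic c)` for `c < max φ`
  above all critical values with `{φ = c} ≠ ∅`: integrability is
  `RegularDomain.nijenhuis_domJ_eq_zero` (the Nijenhuis tensor computed *within* `{φ ≤ c}`,
  `SteinRegularDomain.lean`), convexity the naturality of the Levi form and injectivity of
  `Dι`, the boundary `{φ = c}` (`isBoundaryPoint_sublevel_iff`) the regular maximal level set;
  `sublevel_J_apply`, `sublevel_φ_apply` (definitional unfoldings), `isSteinDomain_sublevel`;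
* `SteinStructure.exists_φ_eq_of_boundary_nonempty` — `{φ = c} ≠ ∅` automatically when
  `∂W ≠ ∅` (minimum of `φ` on the component of a boundary point; Fermat at interior points;
  density of the interior, `Literature.Topology.FourManifolds.dense_interior`);
* **`SteinStructure.exists_forall_isSteinDomain_sublevel`** — for `∂W ≠ ∅` there is
  `c₀ < max φ` such that every `{φ ≤ c}`, `c ∈ [c₀, max φ)`, is a Stein domain diffeomorphic
  to `W` (with `SteinStructure.nonempty_diffeomorph_sublevel`).

## References

* K. Cieliebak, Ya. Eliashberg, *From Stein to Weinstein and Back*, AMS Colloquium Publ. 59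
  (2012), Def. 1.1 ff. (Stein domains as regular sublevel sets of exhausting `J`-convex
  functions), §1, Thm. 1.5, Ch. 8. [CieliebakEliashberg2012]
* Ya. Eliashberg, *Topological characterization of Stein manifolds of dimension > 2*, Internat.
  J. Math. 1 (1990), 29–46, §3. [Eliashberg1990Stein]
* R. E. Gompf, *Handlebody construction of Stein surfaces*, Ann. of Math. 148 (1998), 619–693,
  Thm. 1.3 and the paragraph following it. [Gompf1998]
* J. Milnor, *Morse theory*, Ann. of Math. Studies 51 (1963), Thm. 3.1. [Milnor1963]
-/

noncomputable section

open scoped Manifold ContDiff Topology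
open Set Function Filter VectorField Bundle

namespace Literature.Geometry.Symplectic

open Literature.Topology.FourManifolds

/-! ### The Stein structure of a high sublevel set `{φ ≤ c}` -/

namespace SteinStructure

variable {W : Type*} [TopologicalSpace W] [T2Space W] [ChartedSpace (EuclideanHalfSpace 4) W]
  [IsManifold (𝓡∂ 4) ∞ W] [CompactSpace W] (S : SteinStructure W) {c : ℝ}
  (hc : c < sSup (range S.φ)) (hreg : ∀ x, c ≤ S.φ x → mfderiv (𝓡∂ 4) 𝓘(ℝ, ℝ) S.φ x ≠ 0)

/-- The half-slice atlas of the sublevel set `{φ ≤ c}` of a Stein structure (`c < max φ`, no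
critical point of `φ` of value `≥ c`): the tree's `sublevelAtlas` (`RegularSublevelSet.lean`).
[cite: Milnor1963, Thm. 3.1] -/
def subAtlas : HalfSliceAtlas (𝓡∂ 4) (S.φ ⁻¹' Iic c) :=
  sublevelAtlas (k := 3) S.φ_smooth c (fun _ hp => S.isInteriorPoint_of_φ_le hc hp)
    (fun p hp => hreg p hp.ge)

omit [T2Space W] in
/-- The sublevel set `{φ ≤ c}` is compact. [folklore] -/
theorem compactSpace_sublevel : CompactSpace ↥(S.φ ⁻¹' Iic c) :=
  isCompact_iff_compactSpace.1 ((isClosed_Iic.preimage S.φ_smooth.continuous).isCompact)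

/-- **The restricted almost complex structure** `J^c_p = (Dι_p)⁻¹ ∘ J_p ∘ Dι_p` of the sublevel
set (`RegularDomain.domJ`). [cite: CieliebakEliashberg2012, Def. 1.1 ff.] -/
def subJ (p : ↥(S.φ ⁻¹' Iic c)) : EuclideanSpace ℝ (Fin 4) →L[ℝ] EuclideanSpace ℝ (Fin 4) :=
  letI := (S.subAtlas hc hreg).chartedSpace
  RegularDomain.domJ (S.subAtlas hc hreg) rfl S.J p

omit [T2Space W] in
/-- **The restricted function** `φ ∘ ι`. [folklore] -/
def subφ (_S : SteinStructure W) (c : ℝ) (p : ↥(_S.φ ⁻¹' Iic c)) : ℝ := _S.φ p.1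

omit [T2Space W] in
/-- `φ ∘ ι ≤ c` on the sublevel set. [folklore] -/
theorem subφ_le (p : ↥(S.φ ⁻¹' Iic c)) : S.subφ c p ≤ c := p.2

omit [T2Space W] in
/-- If the level `{φ = c}` is nonempty, `max (φ ∘ ι) = c` on `{φ ≤ c}`. [folklore] -/
theorem sSup_range_subφ (hne : ∃ x, S.φ x = c) : sSup (range (S.subφ c)) = c := by
  obtain ⟨x, hx⟩ := hne
  have h1 : IsGreatest (range (S.subφ c)) c :=
    ⟨⟨⟨x, hx.le⟩, hx⟩, by rintro _ ⟨p, rfl⟩; exact S.subφ_le p⟩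
  exact h1.csSup_eq

omit [T2Space W] in
/-- `φ ∘ ι` is smooth. [folklore] -/
theorem contMDiff_subφ :
    letI := (S.subAtlas hc hreg).chartedSpace
    ContMDiff (𝓡∂ 4) 𝓘(ℝ, ℝ) ∞ (S.subφ c) := by
  letI := (S.subAtlas hc hreg).chartedSpace
  haveI := (S.subAtlas hc hreg).isManifold
  exact S.φ_smooth.comp (RegularDomain.contMDiff_val (S.subAtlas hc hreg) rfl)

omit [T2Space W] in
/-- **The differential of `φ ∘ ι`** is `dφ ∘ Dι`. [folklore] -/
theorem mfderiv_subφ_apply (p : ↥(S.φ ⁻¹' Iic c)) (v : EuclideanSpace ℝ (Fin 4)) :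
    letI := (S.subAtlas hc hreg).chartedSpace
    mfderiv (𝓡∂ 4) 𝓘(ℝ, ℝ) (S.subφ c) p v =
      mfderiv (𝓡∂ 4) 𝓘(ℝ, ℝ) S.φ p.1 (RegularDomain.valDeriv (S.subAtlas hc hreg) rfl p v) := by
  letI := (S.subAtlas hc hreg).chartedSpace
  haveI := (S.subAtlas hc hreg).isManifold
  have hφ : MDifferentiableAt (𝓡∂ 4) 𝓘(ℝ, ℝ) S.φ p.1 := (S.φ_smooth p.1).mdifferentiableAt (by simp)
  have hι : MDifferentiableAt (𝓡∂ 4) (𝓡∂ 4) (Subtype.val : ↥(S.φ ⁻¹' Iic c) → W) p :=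
    (RegularDomain.contMDiff_val (S.subAtlas hc hreg) rfl p).mdifferentiableAt (by simp)
  rw [show S.subφ c = S.φ ∘ Subtype.val from rfl, mfderiv_comp p hφ hι,
    RegularDomain.valDeriv_apply]
  rfl

omit [T2Space W] in
/-- **`d^ℂ(φ ∘ ι)` for `J^c` is the pull-back `ι^* (d^ℂ φ)`.** [folklore] -/
theorem dComplex_sub_eq_pullback :
    letI := (S.subAtlas hc hreg).chartedSpace
    dComplex (S.subJ hc hreg) (S.subφ c) =
      Kaehler.MForm.pullback (I' := 𝓡∂ 4) (𝓡∂ 4) (Subtype.val : ↥(S.φ ⁻¹' Iic c) → W)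
        (dComplex S.J S.φ) := by
  letI := (S.subAtlas hc hreg).chartedSpace
  funext p
  ext v
  rw [dComplex_apply, Kaehler.MForm.pullback_apply, dComplex_apply, mfderiv_subφ_apply]
  show mfderiv (𝓡∂ 4) 𝓘(ℝ, ℝ) S.φ p.1 (RegularDomain.valDeriv (S.subAtlas hc hreg) rfl p
    (RegularDomain.domJ (S.subAtlas hc hreg) rfl S.J p (v 0))) = _
  rw [RegularDomain.valDeriv_domJ, RegularDomain.valDeriv_apply]

/-- **The Levi form of `φ ∘ ι` is that of `φ` on `Dι`-images**:
`-dd^ℂ(φ∘ι)_p (v, J^c v) = -dd^ℂφ_{p} (Dι v, J (Dι v))` (naturality of the tree's `d`,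
`Literature.Geometry.Kaehler.mextDeriv_pullback_apply`, `d^ℂφ` being a smooth form,
`isSmoothForm_dComplex`). [cite: CieliebakEliashberg2012, Def. 1.1 ff.] -/
theorem mextDeriv_dComplex_sub_apply (p : ↥(S.φ ⁻¹' Iic c)) (v : EuclideanSpace ℝ (Fin 4)) :
    letI := (S.subAtlas hc hreg).chartedSpace
    Kaehler.mextDeriv (dComplex (S.subJ hc hreg) (S.subφ c)) p ![v, S.subJ hc hreg p v] =
      Kaehler.mextDeriv (dComplex S.J S.φ) p.1
        ![RegularDomain.valDeriv (S.subAtlas hc hreg) rfl p v,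
          S.J p.1 (RegularDomain.valDeriv (S.subAtlas hc hreg) rfl p v)] := by
  letI := (S.subAtlas hc hreg).chartedSpace
  haveI := (S.subAtlas hc hreg).isManifold
  have hf : ∀ᶠ z in 𝓝 p, ContMDiffAt (𝓡∂ 4) (𝓡∂ 4) ∞ (Subtype.val : ↥(S.φ ⁻¹' Iic c) → W) z :=
    Eventually.of_forall fun z => RegularDomain.contMDiff_val (S.subAtlas hc hreg) rfl z
  have hβ : Kaehler.MForm.SmoothAt (dComplex S.J S.φ) (p : W) := S.isSmoothForm_dComplex p.1
  rw [dComplex_sub_eq_pullback, Kaehler.mextDeriv_pullback_apply hf hβ, Kaehler.MForm.pullback_apply]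
  congr 1
  funext i
  fin_cases i
  · exact (RegularDomain.valDeriv_apply (S.subAtlas hc hreg) rfl p v).symm
  · show mfderiv (𝓡∂ 4) (𝓡∂ 4) Subtype.val p (S.subJ hc hreg p v) = _
    rw [← RegularDomain.valDeriv_apply (S.subAtlas hc hreg) rfl]
    exact RegularDomain.valDeriv_domJ (S.subAtlas hc hreg) rfl S.J p v

/-- **The Stein structure of a high sublevel set `{φ ≤ c}` of a Stein domain** (`c < max φ`,
no critical point of `φ` of value `≥ c`, the level `{φ = c}` nonempty): the restricted almost
complex structure `J^c = (Dι)⁻¹ J Dι` and the restricted function `φ ∘ ι`.  `J² = -1` and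
smoothness of `J^c` are formal; integrability is `RegularDomain.nijenhuis_domJ_eq_zero`
(integrability within the set `{φ ≤ c}`); `J`-convexity is the naturality of the Levi form
(`mextDeriv_dComplex_sub_apply`) and injectivity of `Dι`; the boundary `{φ = c}`
(`isBoundaryPoint_sublevel_iff`) is the maximal level set, regular because `dφ ≠ 0` there and
`Dι` is onto.  This is the statement that a Stein domain in the sense of the tree can be
shrunk into its interior *as a Stein domain* — Cieliebak–Eliashberg's standing description of
Stein domains as regular sublevel sets `{φ ≤ c}` of `J`-convex functions.
[cite: CieliebakEliashberg2012, Def. 1.1 ff.] -/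
def sublevel (hne : ∃ x, S.φ x = c) :
    letI := (S.subAtlas hc hreg).chartedSpace
    haveI := (S.subAtlas hc hreg).isManifold
    haveI := S.compactSpace_sublevel (c := c)
    SteinStructure ↥(S.φ ⁻¹' Iic c) := by
  letI := (S.subAtlas hc hreg).chartedSpace
  haveI := (S.subAtlas hc hreg).isManifold
  haveI := S.compactSpace_sublevel (c := c)
  exact
  { J := S.subJ hc hreg
    φ := S.subφ c
    J_sq := fun p v => RegularDomain.domJ_sq (S.subAtlas hc hreg) rfl S.J S.J_sq p v
    J_smooth := fun X hX =>
      RegularDomain.isSmoothVectorField_domJ (S.subAtlas hc hreg) rfl S.J S.preservesSmoothFields hX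
    integrable := fun X Y hX hY p =>
      RegularDomain.nijenhuis_domJ_eq_zero (S.subAtlas hc hreg) rfl S.J S.preservesSmoothFields
        S.J_sq S.integrable hX hY p
    φ_smooth := S.contMDiff_subφ hc hreg
    convex := fun p v hv => by
      rw [S.mextDeriv_dComplex_sub_apply hc hreg p v]
      exact S.convex p.1 _ fun h0 => hv ((RegularDomain.valDeriv (S.subAtlas hc hreg) rfl p).injective
        (by rw [h0, map_zero]))
    boundary_eq := fun p => by
      rw [S.sSup_range_subφ hne]
      exact isBoundaryPoint_sublevel_iff (k := 3) S.φ_smooth c _ _ p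
    regular := fun p hp => by
      have hpc : S.φ p.1 = c := (isBoundaryPoint_sublevel_iff (k := 3) S.φ_smooth c _ _ p).1 hp
      intro h0
      apply hreg p.1 hpc.ge
      ext u
      have h1 := S.mfderiv_subφ_apply hc hreg p
        ((RegularDomain.valDeriv (S.subAtlas hc hreg) rfl p).symm u)
      rw [h0, ContinuousLinearEquiv.apply_symm_apply] at h1
      exact h1.symm }

/-- The `J` of the restricted structure is `(Dι)⁻¹ ∘ J ∘ Dι` (definitional). [folklore] -/
theorem sublevel_J_apply (hne : ∃ x, S.φ x = c) (p : ↥(S.φ ⁻¹' Iic c)) (v : EuclideanSpace ℝ (Fin 4)) :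
    letI := (S.subAtlas hc hreg).chartedSpace
    haveI := (S.subAtlas hc hreg).isManifold
    haveI := S.compactSpace_sublevel (c := c)
    (S.sublevel hc hreg hne).J p v = (RegularDomain.valDeriv (S.subAtlas hc hreg) rfl p).symm
      (S.J p.1 (RegularDomain.valDeriv (S.subAtlas hc hreg) rfl p v)) := rfl

/-- The `φ` of the restricted structure is `φ ∘ ι` (definitional). [folklore] -/
theorem sublevel_φ_apply (hne : ∃ x, S.φ x = c) (p : ↥(S.φ ⁻¹' Iic c)) :
    letI := (S.subAtlas hc hreg).chartedSpace
    haveI := (S.subAtlas hc hreg).isManifold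
    haveI := S.compactSpace_sublevel (c := c)
    (S.sublevel hc hreg hne).φ p = S.φ p.1 := rfl

/-- **High sublevel sets of a Stein domain are Stein domains.** [cite: CieliebakEliashberg2012, Def. 1.1 ff.] -/
theorem isSteinDomain_sublevel (hne : ∃ x, S.φ x = c) :
    letI := (S.subAtlas hc hreg).chartedSpace
    haveI := (S.subAtlas hc hreg).isManifold
    haveI := S.compactSpace_sublevel (c := c)
    IsSteinDomain ↥(S.φ ⁻¹' Iic c) := by
  letI := (S.subAtlas hc hreg).chartedSpace
  haveI := (S.subAtlas hc hreg).isManifold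
  haveI := S.compactSpace_sublevel (c := c)
  exact ⟨S.sublevel hc hreg hne⟩

/-- **Shrinking a Stein domain, both halves**: the high sublevel set `{φ ≤ c}` (`c < max φ`, no
critical point of value `≥ c`, `{φ = c} ≠ ∅`) is a Stein domain diffeomorphic to `W`
(`isSteinDomain_sublevel` with `SteinStructure.nonempty_diffeomorph_sublevel` of
`SteinDomainShrinking.lean`). [cite: CieliebakEliashberg2012, Def. 1.1 ff.] [cite: Milnor1963, Thm. 3.1] -/
theorem isSteinDomain_sublevel_and_nonempty_diffeomorph (hne : ∃ x, S.φ x = c) :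
    letI := (S.subAtlas hc hreg).chartedSpace
    haveI := (S.subAtlas hc hreg).isManifold
    haveI := S.compactSpace_sublevel (c := c)
    IsSteinDomain ↥(S.φ ⁻¹' Iic c) ∧ Nonempty (W ≃ₘ⟮𝓡∂ 4, 𝓡∂ 4⟯ ↥(S.φ ⁻¹' Iic c)) := by
  letI := (S.subAtlas hc hreg).chartedSpace
  haveI := (S.subAtlas hc hreg).isManifold
  haveI := S.compactSpace_sublevel (c := c)
  exact ⟨S.isSteinDomain_sublevel hc hreg hne, S.nonempty_diffeomorph_sublevel hc hreg⟩


/-! #### The level `{φ = c}` is nonempty as soon as `∂W ≠ ∅` -/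

omit [T2Space W] in
/-- **High levels of `φ` are nonempty when `W` has boundary.**  If `∂W ≠ ∅`, `c < max φ` and
`φ` has no critical point of value `≥ c`, then `{φ = c} ≠ ∅`: on the connected component `C` of
a boundary point (compact, and open since `W` is locally connected) `φ` attains a minimum at
some `x₁`; if `φ x₁ ≤ c` the intermediate value theorem on `C` gives the level; otherwise `x₁`
is a local minimum of `φ` on `W` of value `> c`, hence either an interior critical point of
value `≥ c` (Fermat's theorem in the chart at an interior point) — excluded — or a boundary
point, where `φ = max φ`, forcing `φ ≡ max φ` on the open set `C`, which contains interior
points (`Literature.Topology.FourManifolds.dense_interior`) that would then be boundary points.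
[folklore] -/
theorem exists_φ_eq_of_boundary_nonempty (hc : c < sSup (range S.φ))
    (hreg : ∀ x, c ≤ S.φ x → mfderiv (𝓡∂ 4) 𝓘(ℝ, ℝ) S.φ x ≠ 0)
    (hbW : ((𝓡∂ 4).boundary W).Nonempty) : ∃ x, S.φ x = c := by
  obtain ⟨x₀, hx₀⟩ := hbW
  have hφ₀ : S.φ x₀ = sSup (range S.φ) := (S.boundary_eq x₀).1 hx₀
  have hCc : IsCompact (connectedComponent x₀) := isClosed_connectedComponent.isCompact
  obtain ⟨x₁, hx₁C, hmin⟩ := hCc.exists_isMinOn ⟨x₀, mem_connectedComponent⟩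
    S.φ_smooth.continuous.continuousOn
  by_cases hle : S.φ x₁ ≤ c
  · have hsub := isPreconnected_connectedComponent.intermediate_value hx₁C mem_connectedComponent
      S.φ_smooth.continuous.continuousOn
    obtain ⟨x, -, hx⟩ := hsub ⟨hle, by rw [hφ₀]; exact hc.le⟩
    exact ⟨x, hx⟩
  · exfalso
    replace hle : c < S.φ x₁ := not_le.1 hle
    haveI : LocallyConnectedSpace W := locallyConnectedSpace_of_chartedSpace (W := W)
    have hCo : IsOpen (connectedComponent x₀) := isOpen_connectedComponent
    have hloc : IsLocalMin S.φ x₁ := hmin.isLocalMin (hCo.mem_nhds hx₁C)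
    rcases (𝓡∂ 4).isInteriorPoint_or_isBoundaryPoint x₁ with hint | hbd
    · apply hreg x₁ hle.le
      have hd : MDifferentiableAt (𝓡∂ 4) 𝓘(ℝ, ℝ) S.φ x₁ := (S.φ_smooth x₁).mdifferentiableAt (by simp)
      rw [hd.mfderiv, fderivWithin_of_mem_nhds (range_mem_nhds_isInteriorPoint hint)]
      exact (isLocalMin_writtenInExtChartAt (I := 𝓡∂ 4) hloc).fderiv_eq_zero
    · have hφ₁ : S.φ x₁ = sSup (range S.φ) := (S.boundary_eq x₁).1 hbd
      obtain ⟨q, hqC, hqint⟩ := (dense_interior (I := 𝓡∂ 4) (M := W)).inter_open_nonempty _ hCo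
        ⟨x₀, mem_connectedComponent⟩
      have hφq : S.φ q = sSup (range S.φ) := le_antisymm (S.φ_le_sSup q) (hφ₁ ▸ hmin hqC)
      have hqb : (𝓡∂ 4).IsBoundaryPoint q := (S.boundary_eq q).2 hφq
      exact ((ModelWithCorners.isInteriorPoint_iff_not_isBoundaryPoint q).1 hqint) hqb

/-- **Shrinking a Stein domain with boundary into its interior, as a Stein domain**: if
`∂W ≠ ∅` there is `c₀ < max φ` such that for every `c ∈ [c₀, max φ)` the sublevel set
`{φ ≤ c} ⊂ int W`, with the restricted structure, is a Stein domain diffeomorphic to `W`.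
[cite: CieliebakEliashberg2012, Def. 1.1 ff.] [cite: Milnor1963, Thm. 3.1] -/
theorem exists_forall_isSteinDomain_sublevel (S : SteinStructure W)
    (hbW : ((𝓡∂ 4).boundary W).Nonempty) :
    ∃ c₀ < sSup (range S.φ), ∃ hreg : ∀ x, c₀ ≤ S.φ x → mfderiv (𝓡∂ 4) 𝓘(ℝ, ℝ) S.φ x ≠ 0,
      ∀ (c : ℝ) (hc₀ : c₀ ≤ c) (hc : c < sSup (range S.φ)),
        letI := (S.subAtlas hc (fun x hx => hreg x (hc₀.trans hx))).chartedSpace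
        haveI := (S.subAtlas hc (fun x hx => hreg x (hc₀.trans hx))).isManifold
        haveI := S.compactSpace_sublevel (c := c)
        IsSteinDomain ↥(S.φ ⁻¹' Iic c) ∧ Nonempty (W ≃ₘ⟮𝓡∂ 4, 𝓡∂ 4⟯ ↥(S.φ ⁻¹' Iic c)) := by
  obtain ⟨c₀, hc₀, hreg⟩ := S.exists_lt_sSup_forall_mfderiv_ne_zero
  refine ⟨c₀, hc₀, hreg, fun c hc₀c hc => ?_⟩
  exact S.isSteinDomain_sublevel_and_nonempty_diffeomorph hc (fun x hx => hreg x (hc₀c.trans hx))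
    (S.exists_φ_eq_of_boundary_nonempty hc (fun x hx => hreg x (hc₀c.trans hx)) hbW)

end SteinStructure

end Literature.Geometry.Symplectic

end
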